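import Summits.NavierStokesRegularity.FluidComputer.PalasekTowerSuperposedRunNear

/-!
# THE PERTURBED-DATUM RUN: a bounded classical FREE Navier–Stokes run on a closed slab is shadowed, on the
# whole slab, by the free run from any Schwartz datum uniformly close to its own

Cell `ns-blowup`, seat `ns-blowup-ecbridge-3` (g7; D-0074 GROUP C «BRIDGE SUPPORT», lineage
`host_preparation`; bears_on LADDER-NS N1, route `PalasekTowerBreakdown`, crux `EpisodeBase` = item
stmt-NavierStokesRegularity-19179, line `slot` v5). LABEL: E–C typing + kernel analysis (theorems only;
no definition, no named fact, no `sorry`). WHAT THIS IS NOT: not Navier–Stokes evidence — an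
EXISTENCE-AND-CLOSENESS theorem for the free system next to a GIVEN free classical run on a FIXED slab;
no stage, host, episode or blow-up is constructed or asserted.

## Contents (`ν = 1`, slab `[0, T] × ℝ³`)

Let `(v, q)` be a classical solution of the UNFORCED system on `[0, T] × ℝ³` with finite energy and
`‖v‖ ≤ M`, and let `a'` be a smooth divergence-free Schwartz datum with `‖a' − v(0)‖ ≤ D` everywhere and
`2D · exp (36 C₀² (2M+1)² T) ≤ 1/2`.

* `freeRun_near_of_datum` — every classical finite-energy free run `(u', p')` on `[0, s]`, `s ≤ T`, from `a'`
  satisfies `‖u'(t,x) − v(t,x)‖ ≤ 2D exp (36 C₀² (2M+1)² t) ≤ 1/2` and `‖u'‖ ≤ M + 1/2` (the mild-level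
  bootstrap `Literature.Analysis.FluidPDE.norm_le_of_mildRef_bootstrap` with zero remainder; the a-priori
  bound of the run from Tao's class);
* `freeRun_unique_of_datum` — two such runs agree on their common slab;
* `exists_free_run_near_of_datum` — THE PERTURBED-DATUM RUN: the free run from `a'` exists classically with
  finite energy on the whole slab `[0, T]` and stays within `2D exp (36 C₀² (2M+1)² t)` of `v` (maximal
  classical solution, verbatim the tree's `PerturbedRun.exists_forced_run_near_free_run` /
  `SuperposedRun.exists_free_run_near_superposed`).

Consumer: the approximable-amplifier door of the germ host (a Schwartz mechanism datum, e.g. Gaussian-cored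
vortex rings, is replaced IN THE KERNEL by a compactly supported approximant whose free run shadows the
certified one). References: T. Tao, Anal. PDE 6 (2013), Thm. 5.4 [cite: Tao2011, Thm. 5.4 (ii)+(iv)];
J. Leray, Acta Math. 63 (1934) §19 [cite: Leray1934, §19 (3.4)–(3.8)]; J. C. Robinson, J. L. Rodrigo,
W. Sadowski (2016), Thm. 8.17 [cite: RobinsonRodrigoSadowski2016, Thm. 8.17]; S. Palasek, arXiv:2605.13827 §4
[cite: Palasek2026ElementaryModel, §4].
-/

noncomputable section

namespace Summit.NavierStokesRegularity.FluidComputer.PalasekTowerClayBridge.PerturbedDatum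

open Set MeasureTheory Filter Topology Function Real
open scoped ENNReal NNReal ContDiff
open Literature.Analysis Literature.Analysis.FluidPDE

section Main

variable {T M : ℝ} {v : ℝ → EuclideanSpace ℝ (Fin 3) → EuclideanSpace ℝ (Fin 3)}
  {q : ℝ → EuclideanSpace ℝ (Fin 3) → ℝ} {a' : EuclideanSpace ℝ (Fin 3) → EuclideanSpace ℝ (Fin 3)} {D : ℝ}

variable (hT : 0 < T)
  (hv : IsClassicalNSSolutionOn (Icc 0 T) 1 0 v q)
  (hE : ∃ C : ℝ≥0∞, C < ⊤ ∧ ∀ t ∈ Icc 0 T, ∫⁻ x, ‖v t x‖ₑ ^ 2 ≤ C)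
  (hM : 0 < M) (hbd : ∀ t ∈ Icc 0 T, ∀ y, ‖v t y‖ ≤ M)
  (ha' : HasRapidSpatialDecay a') (hD : ∀ y, ‖a' y - v 0 y‖ ≤ D)
  (hsmall : 2 * D *
    Real.exp (36 * oseenSliceConst (EuclideanSpace ℝ (Fin 3)) ^ 2 * (M + (M + 1)) ^ 2 / 1 * T) ≤ 1 / 2)

include hT hv hE hM hbd ha' hD hsmall

/-- **Every free run from a nearby Schwartz datum stays within the bootstrap bound of the reference run**
(and is bounded by `M + 1/2`). [cite: Tao2011, Thm. 5.4 (ii)+(iv)] [cite: Leray1934, §19 (3.4)–(3.8)] -/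
theorem freeRun_near_of_datum {s : ℝ} (hs0 : 0 < s) (hsT : s ≤ T)
    {u' : ℝ → EuclideanSpace ℝ (Fin 3) → EuclideanSpace ℝ (Fin 3)} {p' : ℝ → EuclideanSpace ℝ (Fin 3) → ℝ}
    (hcl' : IsClassicalNSSolutionOn (Icc 0 s) 1 0 u' p') (hu'0 : u' 0 = a')
    (hE' : ∃ C : ℝ≥0∞, C < ⊤ ∧ ∀ t ∈ Icc 0 s, ∫⁻ x, ‖u' t x‖ₑ ^ 2 ≤ C) :
    ∀ t ∈ Icc 0 s, ∀ x, ‖u' t x - v t x‖ ≤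
        2 * D * Real.exp (36 * oseenSliceConst (EuclideanSpace ℝ (Fin 3)) ^ 2 * (M + (M + 1)) ^ 2 / 1 * t) ∧
      ‖u' t x - v t x‖ ≤ 1 / 2 ∧ ‖u' t x‖ ≤ M + 1 / 2 := by
  have hν : (0 : ℝ) < 1 := one_pos
  set lam : ℝ := 36 * oseenSliceConst (EuclideanSpace ℝ (Fin 3)) ^ 2 * (M + (M + 1)) ^ 2 / 1
    with hlam_def
  have hlam0 : 0 ≤ lam := by positivity
  have hD0 : 0 ≤ D := (norm_nonneg _).trans (hD 0)
  have hsub : Icc 0 s ⊆ Icc 0 T := Icc_subset_Icc le_rfl hsT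
  have hsubo : Ioc 0 s ⊆ Ioc 0 T := Ioc_subset_Ioc le_rfl hsT
  -- the reference run on `[0, s]`: mild identity with zero remainder
  have hvs : IsClassicalNSSolutionOn (Icc 0 s) 1 0 v q := hv.mono hsub (uniqueDiffOn_Icc hs0)
  have hslc : ∀ t ∈ Icc 0 s, Continuous (v t) := fun t ht => (hvs.contDiff_velocity ht).continuous
  have hmeas := SuperposedRun.aestronglyMeasurable_of_classical hvs
  have hrep : ∀ t ∈ Ioc 0 s, v t =ᵐ[volume] fun x =>
      UnboundedOperators.heatExtension (v 0) (1 * t) x - oseenDuhamel 1 0 v v t x +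
        (0 : ℝ → EuclideanSpace ℝ (Fin 3) → EuclideanSpace ℝ (Fin 3)) t x := by
    intro t ht
    have h := SuperposedRun.ae_eq_oseenMild_free hv hT hE hM hbd (hsubo ht)
    filter_upwards [h] with x hx
    rw [hx]; simp
  have hF : ∀ t ∈ Ioc 0 s, ∀ x,
      ‖(0 : ℝ → EuclideanSpace ℝ (Fin 3) → EuclideanSpace ℝ (Fin 3)) t x‖ ≤ 0 := fun t _ x => by simp
  -- the perturbed (free) run: force `0`, bounded by some `B` (Tao class)
  have hgc : Continuous (uncurry (0 : ℝ → EuclideanSpace ℝ (Fin 3) → EuclideanSpace ℝ (Fin 3))) :=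
    continuous_const
  have hG : ∀ τ ∈ Icc 0 s, ∀ y,
      ‖(0 : ℝ → EuclideanSpace ℝ (Fin 3) → EuclideanSpace ℝ (Fin 3)) τ y‖ ≤ 0 := fun τ _ y => by simp
  have hgdiv : ∀ τ ∈ Icc 0 s,
      IsWeaklyDivFree ((0 : ℝ → EuclideanSpace ℝ (Fin 3) → EuclideanSpace ℝ (Fin 3)) τ) :=
    fun τ _ θ _ => by simp
  have hg2 : ∀ τ ∈ Icc 0 s,
      eLpNorm ((0 : ℝ → EuclideanSpace ℝ (Fin 3) → EuclideanSpace ℝ (Fin 3)) τ) 2 volume ≤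
        ENNReal.ofReal 0 := fun τ _ => by simp
  have hE'nn : ∃ C : ℝ≥0, ∀ t ∈ Icc 0 s, ∫⁻ x, ‖u' t x‖ₑ ^ 2 ≤ C := by
    obtain ⟨C, hC, hb⟩ := hE'
    exact ⟨C.toNNReal, fun t ht => (hb t ht).trans (ENNReal.coe_toNNReal hC.ne).ge⟩
  have h0' : HasRapidSpatialDecay (u' 0) := by rw [hu'0]; exact ha'
  have hTao := hcl'.hasBoundedSobolevNormsOn_of_clayForce hν hs0 hE'nn h0'
    Literature.Claims.NS.ClayVariants.isSmoothOnHalfSpace_zero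
    Literature.Claims.NS.ClayVariants.hasRapidSpaceTimeDecay_zero
  obtain ⟨B, -, hB⟩ := HasBoundedSobolevNormsOn.exists_forall_norm_iteratedFDeriv_le hTao
    (fun t ht => hcl'.contDiff_velocity ht) 0
  have hbd' : ∀ t ∈ Icc 0 s, ∀ y, ‖u' t y‖ ≤ B := fun t ht y => by
    simpa using hB t ht y
  have hD' : ∀ y, ‖u' 0 y - v 0 y‖ ≤ D := fun y => by rw [hu'0]; exact hD y
  -- the smallness at `s ≤ T`
  have hΨ : 2 * (D + (0 + 4 * (1 : ℝ) ^ (-(3 / 4 : ℝ)) * s ^ (1 / 4 : ℝ) * 0)) *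
      Real.exp (36 * oseenSliceConst (EuclideanSpace ℝ (Fin 3)) ^ 2 * (M + (M + 1)) ^ 2 / 1 * s) ≤
        1 / 2 := by
    have h1 : Real.exp (lam * s) ≤ Real.exp (lam * T) := Real.exp_le_exp.2 (by nlinarith)
    rw [mul_zero, add_zero, add_zero, ← hlam_def]
    calc 2 * D * Real.exp (lam * s) ≤ 2 * D * Real.exp (lam * T) := by gcongr
      _ ≤ 1 / 2 := by rw [hlam_def]; exact hsmall
  intro t ht x
  have key := sup_stability_mildRef_bootstrap hν hs0 hslc hmeas hM (fun t ht => hbd t (hsub ht)) hrep le_rfl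
    hF hcl' hgc hG hgdiv le_rfl hg2 hE' hbd' hD' hΨ t ht x
  have key2 := norm_le_of_mildRef_bootstrap hν hs0 hslc hmeas hM (fun t ht => hbd t (hsub ht)) hrep le_rfl
    hF hcl' hgc hG hgdiv le_rfl hg2 hE' hbd' hD' hΨ t ht x
  refine ⟨?_, key2.1, key2.2⟩
  have hsimp : 2 * (D + (0 + 4 * (1 : ℝ) ^ (-(3 / 4 : ℝ)) * s ^ (1 / 4 : ℝ) * 0)) = 2 * D := by ring
  rw [hsimp] at key
  exact key

/-- **Free runs from the nearby datum are unique on their common slab.** [cite: Tao2011, Thm. 5.4 (ii)+(iv)] -/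
theorem freeRun_unique_of_datum {s s' : ℝ} (hs0 : 0 < s) (hss' : s ≤ s') (hs'T : s' ≤ T)
    {u₁ u₂ : ℝ → EuclideanSpace ℝ (Fin 3) → EuclideanSpace ℝ (Fin 3)}
    {p₁ p₂ : ℝ → EuclideanSpace ℝ (Fin 3) → ℝ}
    (hu₁ : IsClassicalNSSolutionOn (Icc 0 s) 1 0 u₁ p₁) (hu₁0 : u₁ 0 = a')
    (hEu₁ : ∃ C : ℝ≥0∞, C < ⊤ ∧ ∀ t ∈ Icc 0 s, ∫⁻ x, ‖u₁ t x‖ₑ ^ 2 ≤ C)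
    (hu₂ : IsClassicalNSSolutionOn (Icc 0 s') 1 0 u₂ p₂) (hu₂0 : u₂ 0 = a')
    (hEu₂ : ∃ C : ℝ≥0∞, C < ⊤ ∧ ∀ t ∈ Icc 0 s', ∫⁻ x, ‖u₂ t x‖ₑ ^ 2 ≤ C) :
    ∀ t ∈ Icc 0 s, u₂ t = u₁ t := by
  have hsub : Icc 0 s ⊆ Icc 0 s' := Icc_subset_Icc le_rfl hss'
  have hu₂' : IsClassicalNSSolutionOn (Icc 0 s) 1 0 u₂ p₂ := hu₂.mono hsub (uniqueDiffOn_Icc hs0)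
  have hEu₂' : ∃ C : ℝ≥0∞, C < ⊤ ∧ ∀ t ∈ Icc 0 s, ∫⁻ x, ‖u₂ t x‖ₑ ^ 2 ≤ C := by
    obtain ⟨C, hC, hb⟩ := hEu₂; exact ⟨C, hC, fun t ht => hb t (hsub ht)⟩
  have hB₁ : ∀ t ∈ Icc 0 s, ∀ x, ‖u₁ t x‖ ≤ M + 1 / 2 := fun t ht x =>
    (freeRun_near_of_datum hT hv hE hM hbd ha' hD hsmall hs0 (hss'.trans hs'T) hu₁ hu₁0 hEu₁ t ht x).2.2
  exact velocity_eq_of_bounded_classical one_pos hs0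
    Literature.Claims.NS.ClayVariants.isSmoothOnHalfSpace_zero
    Literature.Claims.NS.ClayVariants.hasRapidSpaceTimeDecay_zero hu₁ hEu₁ hB₁ hu₂' hEu₂'
    (hu₂0.trans hu₁0.symm)

/-- **THE PERTURBED-DATUM RUN.** If moreover `a'` is smooth and divergence free, the UNFORCED Navier–Stokes
system (`ν = 1`) has a classical finite-energy solution `(u, p)` on `[0, T] × ℝ³` with `u 0 = a'` and
`‖u(t,x) − v(t,x)‖ ≤ 2D exp (36 C₀² (2M+1)² t)` for all `t ∈ [0, T]`, `x`.
[cite: Tao2011, Thm. 5.4 (ii)+(iv)] [cite: Leray1934, §19 (3.4)–(3.8)] -/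
theorem exists_free_run_near_of_datum (ha_smooth : ContDiff ℝ ∞ a') (ha_div : VectorCalculus.IsDivFree a') :
    ∃ (u : ℝ → EuclideanSpace ℝ (Fin 3) → EuclideanSpace ℝ (Fin 3))
      (p : ℝ → EuclideanSpace ℝ (Fin 3) → ℝ),
      IsClassicalNSSolutionOn (Icc 0 T) 1 0 u p ∧ u 0 = a' ∧
      (∃ C : ℝ≥0∞, C < ⊤ ∧ ∀ t ∈ Icc 0 T, ∫⁻ x, ‖u t x‖ₑ ^ 2 ≤ C) ∧
      ∀ t ∈ Icc 0 T, ∀ x, ‖u t x - v t x‖ ≤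
        2 * D * Real.exp (36 * oseenSliceConst (EuclideanSpace ℝ (Fin 3)) ^ 2 * (M + (M + 1)) ^ 2 / 1 * t) := by
  classical
  have hν : (0 : ℝ) < 1 := one_pos
  have hs := (Literature.Claims.NS.ClayVariants.isSmoothOnHalfSpace_zero
    (E := EuclideanSpace ℝ (Fin 3)) (F := EuclideanSpace ℝ (Fin 3)))
  have hd := (Literature.Claims.NS.ClayVariants.hasRapidSpaceTimeDecay_zero
    (E := EuclideanSpace ℝ (Fin 3)) (F := EuclideanSpace ℝ (Fin 3)))
  -- the two tools, specialised to the present data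
  have bound := fun {s : ℝ} (hs0 : 0 < s) (hsT : s ≤ T)
      {u' : ℝ → EuclideanSpace ℝ (Fin 3) → EuclideanSpace ℝ (Fin 3)}
      {p' : ℝ → EuclideanSpace ℝ (Fin 3) → ℝ}
      (hcl' : IsClassicalNSSolutionOn (Icc 0 s) 1 0 u' p') (hu'0 : u' 0 = a')
      (hE' : ∃ C : ℝ≥0∞, C < ⊤ ∧ ∀ t ∈ Icc 0 s, ∫⁻ x, ‖u' t x‖ₑ ^ 2 ≤ C) =>
    freeRun_near_of_datum hT hv hE hM hbd ha' hD hsmall hs0 hsT hcl' hu'0 hE'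
  have uniq := fun {s s' : ℝ} (hs0 : 0 < s) (hss' : s ≤ s') (hs'T : s' ≤ T)
      {u₁ u₂ : ℝ → EuclideanSpace ℝ (Fin 3) → EuclideanSpace ℝ (Fin 3)}
      {p₁ p₂ : ℝ → EuclideanSpace ℝ (Fin 3) → ℝ}
      (hu₁ : IsClassicalNSSolutionOn (Icc 0 s) 1 0 u₁ p₁) (hu₁0 : u₁ 0 = a')
      (hEu₁ : ∃ C : ℝ≥0∞, C < ⊤ ∧ ∀ t ∈ Icc 0 s, ∫⁻ x, ‖u₁ t x‖ₑ ^ 2 ≤ C)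
      (hu₂ : IsClassicalNSSolutionOn (Icc 0 s') 1 0 u₂ p₂) (hu₂0 : u₂ 0 = a')
      (hEu₂ : ∃ C : ℝ≥0∞, C < ⊤ ∧ ∀ t ∈ Icc 0 s', ∫⁻ x, ‖u₂ t x‖ₑ ^ 2 ≤ C) =>
    freeRun_unique_of_datum hT hv hE hM hbd ha' hD hsmall hs0 hss' hs'T hu₁ hu₁0 hEu₁ hu₂ hu₂0 hEu₂
  -- ### force bookkeeping for the zero force
  obtain ⟨Cf₀, Cf₁, Bf, -, hCf₀, -, -⟩ := ForcedContinuation.exists_force_slice_bounds hs hd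
  have hfE : ∀ s : ℝ, s ≤ T →
      ∫⁻ t in Icc 0 s, (∫⁻ x, ‖(0 : ℝ → EuclideanSpace ℝ (Fin 3) → EuclideanSpace ℝ (Fin 3)) t x‖ₑ ^ 2) ^
          (1 / 2 : ℝ) ≤
        ∫⁻ t in Icc 0 T, (∫⁻ x, ‖(0 : ℝ → EuclideanSpace ℝ (Fin 3) → EuclideanSpace ℝ (Fin 3)) t x‖ₑ ^ 2) ^
          (1 / 2 : ℝ) :=
    fun s hsT => lintegral_mono_set (Icc_subset_Icc le_rfl hsT)
  have hfET : ∫⁻ t in Icc 0 T,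
      (∫⁻ x, ‖(0 : ℝ → EuclideanSpace ℝ (Fin 3) → EuclideanSpace ℝ (Fin 3)) t x‖ₑ ^ 2) ^ (1 / 2 : ℝ) < ⊤ := by
    calc ∫⁻ t in Icc 0 T,
          (∫⁻ x, ‖(0 : ℝ → EuclideanSpace ℝ (Fin 3) → EuclideanSpace ℝ (Fin 3)) t x‖ₑ ^ 2) ^ (1 / 2 : ℝ)
        ≤ ∫⁻ _t in Icc 0 T, (Cf₀ : ℝ≥0∞) ^ (1 / 2 : ℝ) :=
          setLIntegral_mono' measurableSet_Icc fun t ht =>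
            ENNReal.rpow_le_rpow (hCf₀ t ht.1) (by norm_num)
      _ = (Cf₀ : ℝ≥0∞) ^ (1 / 2 : ℝ) * volume (Icc (0 : ℝ) T) := setLIntegral_const _ _
      _ < ⊤ := by
          rw [Real.volume_Icc]
          exact ENNReal.mul_lt_top (ENNReal.rpow_lt_top_of_nonneg (by norm_num) ENNReal.coe_ne_top)
            ENNReal.ofReal_lt_top
  have ha_L2 : ∫⁻ x, ‖a' x‖ₑ ^ 2 < ⊤ := by
    have h : ∫⁻ x, ‖iteratedFDeriv ℝ 0 a' x‖ₑ ^ 2 < ⊤ := ha'.lintegral_enorm_iteratedFDeriv_sq_lt_top 0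
    have heq : ∫⁻ x, ‖a' x‖ₑ ^ 2 = ∫⁻ x, ‖iteratedFDeriv ℝ 0 a' x‖ₑ ^ 2 :=
      lintegral_congr fun x => by rw [← ofReal_norm, ← ofReal_norm, norm_iteratedFDeriv_zero]
    rw [heq]; exact h
  -- ### the set of existence times and its supremum
  set 𝒮 : Set ℝ := {s | 0 < s ∧ s ≤ T ∧
      ∃ (u' : ℝ → EuclideanSpace ℝ (Fin 3) → EuclideanSpace ℝ (Fin 3))
        (p' : ℝ → EuclideanSpace ℝ (Fin 3) → ℝ),
        IsClassicalNSSolutionOn (Icc 0 s) 1 0 u' p' ∧ u' 0 = a' ∧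
        (∃ C : ℝ≥0∞, C < ⊤ ∧ ∀ t ∈ Icc 0 s, ∫⁻ x, ‖u' t x‖ₑ ^ 2 ≤ C)} with h𝒮
  obtain ⟨s₁, hs₁pos, hs₁T, u₁, p₁, hu₁, hu₁0, hE₁'⟩ :=
    PerturbedRun.exists_local_forcedRun
      (f := (0 : ℝ → EuclideanSpace ℝ (Fin 3) → EuclideanSpace ℝ (Fin 3))) hν hT hs hd ha_smooth ha_div ha'
  have hs₁mem : s₁ ∈ 𝒮 := ⟨hs₁pos, hs₁T, u₁, p₁, hu₁, hu₁0, hE₁'⟩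
  have h𝒮ne : 𝒮.Nonempty := ⟨s₁, hs₁mem⟩
  have h𝒮bdd : BddAbove 𝒮 := ⟨T, fun s hs => hs.2.1⟩
  set sStar : ℝ := sSup 𝒮 with hsStar
  have hs₁le : s₁ ≤ sStar := le_csSup h𝒮bdd hs₁mem
  have hsStarpos : 0 < sStar := lt_of_lt_of_le hs₁pos hs₁le
  have hsStarT : sStar ≤ T := csSup_le h𝒮ne fun s hs => hs.2.1
  have hrun : ∀ s ∈ Ioo 0 sStar,
      ∃ (u' : ℝ → EuclideanSpace ℝ (Fin 3) → EuclideanSpace ℝ (Fin 3))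
        (p' : ℝ → EuclideanSpace ℝ (Fin 3) → ℝ),
        IsClassicalNSSolutionOn (Icc 0 s) 1 0 u' p' ∧ u' 0 = a' ∧
        (∃ C : ℝ≥0∞, C < ⊤ ∧ ∀ t ∈ Icc 0 s, ∫⁻ x, ‖u' t x‖ₑ ^ 2 ≤ C) := by
    intro s hs
    obtain ⟨s', hs'mem, hss'⟩ := exists_lt_of_lt_csSup h𝒮ne hs.2
    obtain ⟨-, -, u', p', hu', hu'0, hE'⟩ := hs'mem
    have hsub : Icc 0 s ⊆ Icc 0 s' := Icc_subset_Icc le_rfl hss'.le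
    refine ⟨u', p', hu'.mono hsub (uniqueDiffOn_Icc hs.1), hu'0, ?_⟩
    obtain ⟨C, hC, hb⟩ := hE'
    exact ⟨C, hC, fun t ht => hb t (hsub ht)⟩
  -- ### the coherent union on `[0, s⋆)`
  have hσ : ∀ t ∈ Ico 0 sStar, (t + sStar) / 2 ∈ Ioo 0 sStar ∧ t < (t + sStar) / 2 := fun t ht =>
    ⟨⟨by linarith [ht.1], by linarith [ht.2]⟩, by linarith [ht.2]⟩
  have hchoice : ∀ t : ℝ, ∃ (u' : ℝ → EuclideanSpace ℝ (Fin 3) → EuclideanSpace ℝ (Fin 3))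
      (p' : ℝ → EuclideanSpace ℝ (Fin 3) → ℝ), t ∈ Ico 0 sStar →
        IsClassicalNSSolutionOn (Icc 0 ((t + sStar) / 2)) 1 0 u' p' ∧ u' 0 = a' ∧
        (∃ C : ℝ≥0∞, C < ⊤ ∧ ∀ τ ∈ Icc 0 ((t + sStar) / 2), ∫⁻ x, ‖u' τ x‖ₑ ^ 2 ≤ C) := by
    intro t
    by_cases ht : t ∈ Ico 0 sStar
    · obtain ⟨u', p', h⟩ := hrun _ (hσ t ht).1
      exact ⟨u', p', fun _ => h⟩
    · exact ⟨fun _ _ => 0, fun _ _ => 0, fun h => absurd h ht⟩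
  choose Uf Pf hUP using hchoice
  set Us : ℝ → EuclideanSpace ℝ (Fin 3) → EuclideanSpace ℝ (Fin 3) := fun t => Uf t t with hUs
  set Ps : ℝ → EuclideanSpace ℝ (Fin 3) → ℝ := fun t x => Pf t t x - Pf t t 0 with hPs
  have hagree : ∀ t₀ ∈ Ico 0 sStar, ∀ t ∈ Ico 0 ((t₀ + sStar) / 2),
      Us t = Uf t₀ t ∧ ∀ x, Ps t x = Pf t₀ t x - Pf t₀ t 0 := by
    intro t₀ ht₀ t ht
    obtain ⟨hσ₀, -⟩ := hσ t₀ ht₀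
    have htS : t ∈ Ico 0 sStar := ⟨ht.1, ht.2.trans hσ₀.2⟩
    obtain ⟨hσt, htσt⟩ := hσ t htS
    obtain ⟨hcl₀, h0₀, hE₀⟩ := hUP t₀ ht₀
    obtain ⟨hclt, h0t, hEt⟩ := hUP t htS
    set m : ℝ := min ((t + sStar) / 2) ((t₀ + sStar) / 2) with hm
    have htm : t < m := lt_min htσt ht.2
    have hm₁ : m ≤ (t + sStar) / 2 := min_le_left _ _
    have hm₂ : m ≤ (t₀ + sStar) / 2 := min_le_right _ _
    have heq : ∀ τ ∈ Icc 0 m, Uf t τ = Uf t₀ τ := by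
      rcases le_total ((t + sStar) / 2) ((t₀ + sStar) / 2) with hle | hle
      · have hmeq : m = (t + sStar) / 2 := min_eq_left hle
        intro τ hτ
        rw [hmeq] at hτ
        exact (uniq hσt.1 hle (hσ₀.2.le.trans hsStarT) hclt h0t hEt hcl₀ h0₀ hE₀ τ hτ).symm
      · have hmeq : m = (t₀ + sStar) / 2 := min_eq_right hle
        intro τ hτ
        rw [hmeq] at hτ
        exact uniq hσ₀.1 hle (hσt.2.le.trans hsStarT) hcl₀ h0₀ hE₀ hclt h0t hEt τ hτ
    refine ⟨heq t ⟨ht.1, htm.le⟩, fun x => ?_⟩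
    exact PerturbedRun.pressure_sub_apply_zero_eq_of_eqOn_Icc hclt hcl₀ hm₁ hm₂ heq ⟨ht.1, htm⟩ x
  have hIcc : ∀ τ₁ ∈ Ioo 0 sStar, IsClassicalNSSolutionOn (Icc 0 τ₁) 1 0 Us Ps := by
    intro τ₁ hτ₁
    have hτ₁' : τ₁ ∈ Ico 0 sStar := ⟨hτ₁.1.le, hτ₁.2⟩
    obtain ⟨-, hτσ₁⟩ := hσ τ₁ hτ₁'
    obtain ⟨hcl₁, -, -⟩ := hUP τ₁ hτ₁'
    have hsub : Icc 0 τ₁ ⊆ Icc 0 ((τ₁ + sStar) / 2) := Icc_subset_Icc le_rfl hτσ₁.le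
    have h1 : IsClassicalNSSolutionOn (Icc 0 τ₁) 1 0 (Uf τ₁) (fun t x => Pf τ₁ t x - Pf τ₁ t 0) :=
      (PerturbedRun.normalise_pressure hcl₁).mono hsub (uniqueDiffOn_Icc hτ₁.1)
    have hmemσ : ∀ t ∈ Icc 0 τ₁, t ∈ Ico 0 ((τ₁ + sStar) / 2) := fun t ht =>
      ⟨ht.1, lt_of_le_of_lt ht.2 hτσ₁⟩
    exact PerturbedRun.congr_pressure' (h1.congr_velocity fun t ht => (hagree τ₁ hτ₁' t (hmemσ t ht)).1)
      fun t ht => funext fun x => ((hagree τ₁ hτ₁' t (hmemσ t ht)).2 x)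
  have hIco : IsClassicalNSSolutionOn (Ico 0 sStar) 1 0 Us Ps :=
    PerturbedRun.isClassicalNSSolutionOn_Ico_of_forall_Icc hsStarpos hIcc
  have hUs0 : Us 0 = a' := by
    obtain ⟨-, h00, -⟩ := hUP 0 ⟨le_rfl, hsStarpos⟩
    exact h00
  have hUsM : ∀ t ∈ Ico 0 sStar, ∀ x, ‖Us t x‖ ≤ M + 1 / 2 := by
    intro t ht x
    obtain ⟨hσt, htσt⟩ := hσ t ht
    obtain ⟨hclt, h0t, hEt⟩ := hUP t ht
    exact (bound hσt.1 (hσt.2.le.trans hsStarT) hclt h0t hEt t ⟨ht.1, htσt.le⟩ x).2.2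
  obtain ⟨CE, hCEtop, hEn⟩ := tao2011_forced_finiteEnergy_energyBound_holds
  set Ebd : ℝ≥0∞ := CE * ((∫⁻ x, ‖a' x‖ₑ ^ 2) ^ (1 / 2 : ℝ) +
    ∫⁻ t in Icc 0 T,
      (∫⁻ x, ‖(0 : ℝ → EuclideanSpace ℝ (Fin 3) → EuclideanSpace ℝ (Fin 3)) t x‖ₑ ^ 2) ^ (1 / 2 : ℝ)) ^ 2
    with hEbd
  have hEbdtop : Ebd < ⊤ := by
    refine ENNReal.mul_lt_top hCEtop (ENNReal.pow_lt_top (ENNReal.add_lt_top.2 ⟨?_, hfET⟩))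
    exact ENNReal.rpow_lt_top_of_nonneg (by norm_num) ha_L2.ne
  have hUsE : ∃ C : ℝ≥0∞, C < ⊤ ∧ ∀ t ∈ Ico 0 sStar, ∫⁻ x, ‖Us t x‖ₑ ^ 2 ≤ C := by
    refine ⟨Ebd, hEbdtop, fun t ht => ?_⟩
    obtain ⟨hσt, htσt⟩ := hσ t ht
    obtain ⟨hclt, h0t, hEt⟩ := hUP t ht
    have hEA : ∃ A : ℝ≥0, ∀ τ ∈ Icc 0 ((t + sStar) / 2), ∫⁻ x, ‖Uf t τ x‖ₑ ^ 2 ≤ A := by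
      obtain ⟨C, hC, hb⟩ := hEt
      exact ⟨C.toNNReal, fun τ hτ => (hb τ hτ).trans (ENNReal.coe_toNNReal hC.ne).ge⟩
    have hfEσ : ∫⁻ τ in Icc 0 ((t + sStar) / 2),
        (∫⁻ x, ‖(0 : ℝ → EuclideanSpace ℝ (Fin 3) → EuclideanSpace ℝ (Fin 3)) τ x‖ₑ ^ 2) ^ (1 / 2 : ℝ) <
          ⊤ :=
      lt_of_le_of_lt (hfE _ (hσt.2.le.trans hsStarT)) hfET
    have h1 := (hEn hν hσt.1 hclt (hs.isSmoothSpaceTimeOn_Icc _) hfEσ hEA).1 t ⟨ht.1, htσt.le⟩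
    rw [h0t] at h1
    refine h1.trans ?_
    rw [hEbd]
    gcongr
    exact hσt.2.le.trans hsStarT
  have hUs0' : HasRapidSpatialDecay (Us 0) := by rw [hUs0]; exact ha'
  -- ### extension past `s⋆`: hence `s⋆ = T` and `T` is an existence time
  obtain ⟨T'', hT'', U, P, hU, hUeq, hUE⟩ :=
    ForcedContinuation.exists_extension_of_bounded_Ico hν hsStarpos hs hd hIco hUsE hUsM hUs0'
  have hU0 : U 0 = a' := by rw [hUeq 0 ⟨le_rfl, hsStarpos⟩, hUs0]
  set T₁ : ℝ := min T'' T with hT₁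
  have hT₁pos : 0 < T₁ := lt_min (hsStarpos.trans hT'') hT
  have hT₁T : T₁ ≤ T := min_le_right _ _
  have hT₁mem : T₁ ∈ 𝒮 := by
    have hsub : Icc 0 T₁ ⊆ Icc 0 T'' := Icc_subset_Icc le_rfl (min_le_left _ _)
    refine ⟨hT₁pos, hT₁T, U, P, hU.mono hsub (uniqueDiffOn_Icc hT₁pos), hU0, ?_⟩
    obtain ⟨C, hC, hb⟩ := hUE
    exact ⟨C, hC, fun t ht => hb t (hsub ht)⟩
  have hT₁le : T₁ ≤ sStar := le_csSup h𝒮bdd hT₁mem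
  have hT₁eq : T₁ = T := by
    rcases le_total T'' T with h | h
    · exfalso
      have : T₁ = T'' := min_eq_left h
      linarith
    · exact min_eq_right h
  rw [hT₁eq] at hT₁mem
  obtain ⟨-, -, u', p', hcl', hu'0, hE'⟩ := hT₁mem
  exact ⟨u', p', hcl', hu'0, hE', fun t ht x => (bound hT le_rfl hcl' hu'0 hE' t ht x).1⟩

end Main

end Summit.NavierStokesRegularity.FluidComputer.PalasekTowerClayBridge.PerturbedDatum

end
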